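import Mathlib
import Summits.MatrixMultiplication.MatrixMultiplication.Theses.FourierTwoFamiliesModP
import Summits.MatrixMultiplication.MatrixMultiplication.Theorems.PrimeTwoFamilies.Negative.Slices
import Literature.Computability.AlgebraicComplexity.BideterminantReductionWeights

/-!
# Crux `PrimeTwoFamilies` (stmt-MatrixMultiplication-14308), stub `stub_capacityTransfer` — explicit digit route

Route `FourierTwoFamiliesModP`, line `Sketch` (capacity form).  The registered stub says: CAPACITY GADGETS
(for every `ε > 0`, arbitrarily large `m`, a gadget of direct pairs `(P c, Q c)` in `ℤ/m` of co-volume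
`≥ m^{1-ε}`, and a zero-error code `W` of words `Fin L → Fin r`, `L ≥ 1`, `|W| ≥ (m^L)^{1/2-ε}`, every
ordered pair of distinct words strongly separated in some coordinate) give every slice `0 < δ ≤ 1` of
the crux (`PrimeTwoFamiliesAt δ`: arbitrarily large `n`, a prime `p ≤ n^{2+δ}`, `n` SDPP pairs in `ℤ/p`
of co-volume `≥ n^{2-δ}`).

This file is a SELF-CONTAINED, EXPLICIT proof (siege variation "explicit / elementary"; the tree's
first proof, `Theorems.PrimeTwoFamilies.CapacityLift.stub_capacityTransfer`, goes through the abstract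
carry-free transfer `exists_prime_sdpp_of_addEquiv`, i.e. the Freiman-3 mixed-radix map and a host
`p ≤ 2·3^L·m^L`).  Here the host map is written down:

* `V x := ∑ₜ val (x t) · (2m)^t ∈ ℕ` — the base-`2m` valuation of a word `x : Fin L → ℤ/m` (digits are
  the canonical representatives `val (x t) ∈ [0, m)`).  Two-fold sums have digits
  `val (a t) + val (b t) < 2m`, so NO CARRIES occur: `V a + V b` determines `a + b` (`wordVal_reflect`,
  from the uniqueness of base-`D` digit expansions — the tree's
  `Literature.…AlgebraicComplexity.AndrewsForbes.digits_injective`) and is `< (2m)^L`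
  (`wordVal_add_lt`, from `digitSum_lt`).
* Reducing modulo a Bertrand prime `p ∈ ((2m)^L, 2·(2m)^L]` keeps both facts, so
  `φ x := V x mod p` reflects two-fold sums `φ a + φ b = φ a' + φ b' ⟹ a + b = a' + b'` and is
  injective; the images of the product blocks `∏ₜ P (w t)`, `∏ₜ Q (w t)` (`w ∈ W`) are SDPP pairs in `ℤ/p`
  of the same sizes (clause (W) coordinatewise from directness, clause (X) from the separating
  coordinate of the code).
* `capacityTransferK6_bookkeeping` — explicit exponent bookkeeping, uniform in `L ≥ 1`, with the explicit
  number of pairs `n := ⌈(m^L)^{1/2-δ/16}⌉₊`: once `4 ≤ m^{5δ/16}` and `n₀ ≤ m^{1/2-δ/16}` one has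
  `n₀ ≤ n ≤ |W|`, `p ≤ 2·(2m)^L ≤ 4^L m^L ≤ (m^L)^{1+5δ/16} ≤ n^{2+δ}` and
  `n^{2-δ} ≤ 4 (m^L)^{1-9δ/16} ≤ (m^{1-δ/16})^L ≤` co-volume.

Helper file landed `--supports stmt-MatrixMultiplication-14308`; the final statement is the registered stub
signature verbatim (all clauses inlined; no definitions — the valuation `V` is written out as a sum).
-/

-- single-conjunct summit: the mandated namespace repeats `MatrixMultiplication`.
set_option linter.dupNamespace false

namespace Summit.MatrixMultiplication.MatrixMultiplication.Theorems.PrimeTwoFamilies.CapacityTransferK6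

open Finset
open Summit.MatrixMultiplication.MatrixMultiplication.Theses
open Summit.MatrixMultiplication.MatrixMultiplication.Theorems.PrimeTwoFamilies.Negative
open Literature.Computability.AlgebraicComplexity

/-! ## Base-`D` digit sums (no carries) -/

/-- Peeling off the lowest digit: `∑_{t<L+1} f t · D^t = f 0 + D · ∑_{t<L} f (t+1) · D^t`. -/
theorem digitSum_succ {D L : ℕ} (f : Fin (L + 1) → ℕ) :
    ∑ t, f t * D ^ (t : ℕ) = f 0 + D * ∑ t : Fin L, f t.succ * D ^ (t : ℕ) := by
  rw [Fin.sum_univ_succ, Finset.mul_sum]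
  simp only [Fin.val_zero, pow_zero, mul_one, Fin.val_succ, pow_succ]
  refine congrArg _ (Finset.sum_congr rfl fun t _ => ?_)
  ring

/-- A base-`D` digit sum with `L` digits `< D` is `< D^L`. -/
theorem digitSum_lt {D : ℕ} :
    ∀ {L : ℕ} (d : Fin L → ℕ), (∀ t, d t < D) → ∑ t, d t * D ^ (t : ℕ) < D ^ L
  | 0, d, _ => by simp
  | L + 1, d, hd => by
      rw [digitSum_succ]
      have ih := digitSum_lt (fun t => d t.succ) fun t => hd _
      have h0 := hd 0
      calc d 0 + D * ∑ t : Fin L, d t.succ * D ^ (t : ℕ)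
          < D + D * ∑ t : Fin L, d t.succ * D ^ (t : ℕ) := by omega
        _ = D * (∑ t : Fin L, d t.succ * D ^ (t : ℕ) + 1) := by ring
        _ ≤ D * D ^ L := Nat.mul_le_mul_left _ ih
        _ = D ^ (L + 1) := by ring

/-! ## The explicit carry-free valuation of words over `ℤ/m` -/

/-- Two-fold sums of base-`2m` valuations `V x = ∑ₜ val (x t) · (2m)^t` of words `x : Fin L → ℤ/m` stay
below `(2m)^L` (their digits `val (a t) + val (b t)` are `< 2m`). -/
theorem wordVal_add_lt {m L : ℕ} [NeZero m] (a b : Fin L → ZMod m) :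
    ∑ t, (a t).val * (2 * m) ^ (t : ℕ) + ∑ t, (b t).val * (2 * m) ^ (t : ℕ) < (2 * m) ^ L := by
  rw [← Finset.sum_add_distrib]
  simp_rw [← add_mul]
  exact digitSum_lt (D := 2 * m) (fun t => (a t).val + (b t).val) fun t => by
    have := ZMod.val_lt (a t); have := ZMod.val_lt (b t); omega

/-- **The base-`2m` valuation `V x = ∑ₜ val (x t) · (2m)^t` reflects two-fold sums**:
`V a + V b = V a' + V b'` forces `a + b = a' + b'` in `Fin L → ℤ/m` (no carries: the digit vectors
`val (a t) + val (b t)` agree, hence so do their residues `a t + b t` mod `m`). -/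
theorem wordVal_reflect {m L : ℕ} [NeZero m] (a b a' b' : Fin L → ZMod m)
    (h : ∑ t, (a t).val * (2 * m) ^ (t : ℕ) + ∑ t, (b t).val * (2 * m) ^ (t : ℕ) =
      ∑ t, (a' t).val * (2 * m) ^ (t : ℕ) + ∑ t, (b' t).val * (2 * m) ^ (t : ℕ)) :
    a + b = a' + b' := by
  rw [← Finset.sum_add_distrib, ← Finset.sum_add_distrib] at h
  simp_rw [← add_mul] at h
  have key := AndrewsForbes.digits_injective (b := 2 * m) (by have := NeZero.pos m; omega)
    (fun t => (a t).val + (b t).val) (fun t => (a' t).val + (b' t).val)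
    (fun t => by have := ZMod.val_lt (a t); have := ZMod.val_lt (b t); omega)
    (fun t => by have := ZMod.val_lt (a' t); have := ZMod.val_lt (b' t); omega) h
  funext t
  have ht : (a t).val + (b t).val = (a' t).val + (b' t).val := congrFun key t
  have hc := congrArg (fun k : ℕ => (k : ZMod m)) ht
  simp only [Nat.cast_add, ZMod.natCast_zmod_val] at hc
  exact hc

/-! ## Explicit exponent bookkeeping -/

/-- A constant is eventually below a fixed positive power of the level: `K ≤ m ^ g` for all natural
`m ≥ ⌈K^{1/g}⌉₊`. -/
theorem capacityTransferK6_eventually_le_rpow (K g : ℝ) (hK : 0 ≤ K) (hg : 0 < g) :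
    ∃ m₀ : ℕ, ∀ m : ℕ, m₀ ≤ m → K ≤ (m : ℝ) ^ g := by
  refine ⟨⌈K ^ (1 / g)⌉₊, fun m hm => ?_⟩
  have hKm : K ^ (1 / g) ≤ m := (Nat.le_ceil _).trans (by exact_mod_cast hm)
  calc K = (K ^ (1 / g)) ^ g := by rw [← Real.rpow_mul hK, one_div_mul_cancel hg.ne', Real.rpow_one]
    _ ≤ (m : ℝ) ^ g := Real.rpow_le_rpow (Real.rpow_nonneg hK _) hKm hg.le

/-- Commuting a real and a natural exponent: `(m ^ g) ^ L = (m ^ L) ^ g` for `m ≥ 0`. -/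
theorem capacityTransferK6_rpow_pow_comm {m : ℝ} (hm : 0 ≤ m) (g : ℝ) (L : ℕ) :
    (m ^ g) ^ L = (m ^ L) ^ g := by
  rw [← Real.rpow_mul_natCast hm, mul_comm, Real.rpow_natCast_mul hm]

/-- **Bookkeeping, explicit and uniform in `L`.**  For `0 < δ ≤ 1` and every `n₀` there is a threshold
`m₀` (depending on `δ, n₀` only: `m ≥ 1`, `4 ≤ m^{5δ/16}`, `n₀ ≤ m^{1/2-δ/16}`) such that for every
`m ≥ m₀`, `L ≥ 1`, every code size `N ≥ (m^L)^{1/2-δ/16}` and every host size `p ≤ 2·(2m)^L` the EXPLICIT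
number of pairs `n := ⌈(m^L)^{1/2-δ/16}⌉₊` satisfies `n₀ ≤ n ≤ N`, `p ≤ n^{2+δ}` and
`n^{2-δ} ≤ (m^{1-δ/16})^L`.  With `M := m^L ≥ m ≥ 1`: `p ≤ 2·2^L·M ≤ 4^L M ≤ M^{5δ/16} M ≤
M^{(1/2-δ/16)(2+δ)} ≤ n^{2+δ}` (as `δ² ≤ δ`), and `n ≤ M^{1/2-δ/16} + 1 ≤ 2 M^{1/2-δ/16}` gives
`n^{2-δ} ≤ 4 M^{(1/2-δ/16)(2-δ)} ≤ M^{δ/2} M^{1-9δ/16} = M^{1-δ/16}`. -/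
theorem capacityTransferK6_bookkeeping {δ : ℝ} (hδ : 0 < δ) (hδ1 : δ ≤ 1) (n₀ : ℕ) :
    ∃ m₀ : ℕ, ∀ m : ℕ, m₀ ≤ m → ∀ L : ℕ, 1 ≤ L →
      ∀ N : ℕ, ((m : ℝ) ^ (L : ℝ)) ^ (1 / 2 - δ / 16) ≤ (N : ℝ) →
      ∀ p : ℕ, p ≤ 2 * (2 * m) ^ L →
        ∃ n : ℕ, n₀ ≤ n ∧ n ≤ N ∧ (p : ℝ) ≤ (n : ℝ) ^ (2 + δ) ∧
          (n : ℝ) ^ (2 - δ) ≤ ((m : ℝ) ^ (1 - δ / 16)) ^ L := by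
  have hδδ : δ * δ ≤ δ * 1 := mul_le_mul_of_nonneg_left hδ1 hδ.le
  obtain ⟨m₁, hm₁⟩ :=
    capacityTransferK6_eventually_le_rpow 4 (5 * δ / 16) (by norm_num) (by positivity)
  obtain ⟨m₂, hm₂⟩ :=
    capacityTransferK6_eventually_le_rpow (n₀ : ℝ) (1 / 2 - δ / 16) (Nat.cast_nonneg _) (by linarith)
  refine ⟨max 1 (max m₁ m₂), fun m hm L hL N hN p hp => ?_⟩
  have hm1 : 1 ≤ m := le_trans (le_max_left _ _) hm
  have hmm₁ : m₁ ≤ m := le_trans (le_trans (le_max_left _ _) (le_max_right _ _)) hm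
  have hmm₂ : m₂ ≤ m := le_trans (le_trans (le_max_right _ _) (le_max_right _ _)) hm
  have hm1R : (1 : ℝ) ≤ m := by exact_mod_cast hm1
  have hm0R : (0 : ℝ) ≤ m := zero_le_one.trans hm1R
  rw [Real.rpow_natCast] at hN
  -- the real size `M = m ^ L ≥ m ≥ 1` of the word space
  set M : ℝ := (m : ℝ) ^ L with hM
  have hmM : (m : ℝ) ≤ M := le_self_pow₀ hm1R (by omega)
  have hM1 : 1 ≤ M := hm1R.trans hmM
  have hM0 : 0 < M := one_pos.trans_le hM1
  -- the two threshold facts, moved from `m` to `M`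
  have h4m : (4 : ℝ) ≤ (m : ℝ) ^ (5 * δ / 16) := hm₁ m hmm₁
  have h4M : (4 : ℝ) ≤ M ^ (δ / 2) :=
    h4m.trans ((Real.rpow_le_rpow hm0R hmM (by positivity)).trans
      (Real.rpow_le_rpow_of_exponent_le hM1 (by linarith)))
  -- the explicit number of pairs `n = ⌈x⌉₊`, `x = M ^ (1/2 - δ/16)`
  set x : ℝ := M ^ (1 / 2 - δ / 16) with hx
  have hx1 : 1 ≤ x := Real.one_le_rpow hM1 (by linarith)
  have hx0 : 0 ≤ x := zero_le_one.trans hx1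
  have hxn : x ≤ (⌈x⌉₊ : ℕ) := Nat.le_ceil x
  have hn2x : ((⌈x⌉₊ : ℕ) : ℝ) ≤ 2 * x := by
    have := Nat.ceil_lt_add_one hx0
    linarith
  have hn0 : (0 : ℝ) ≤ ((⌈x⌉₊ : ℕ) : ℝ) := Nat.cast_nonneg _
  refine ⟨⌈x⌉₊, ?_, Nat.ceil_le.2 hN, ?_, ?_⟩
  · -- `n₀ ≤ n`
    have h1 : (n₀ : ℝ) ≤ (m : ℝ) ^ (1 / 2 - δ / 16) := hm₂ m hmm₂
    have h2 : (m : ℝ) ^ (1 / 2 - δ / 16) ≤ x := Real.rpow_le_rpow hm0R hmM (by linarith)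
    exact_mod_cast (h1.trans h2).trans hxn
  · -- `p ≤ n ^ (2 + δ)`
    have h1 : (p : ℝ) ≤ 2 * (2 * (m : ℝ)) ^ L := by exact_mod_cast hp
    have h2 : (2 : ℝ) * (2 * (m : ℝ)) ^ L ≤ 4 ^ L * M := by
      rw [mul_pow, ← mul_assoc]
      refine mul_le_mul_of_nonneg_right ?_ (by positivity)
      calc (2 : ℝ) * 2 ^ L ≤ 2 ^ L * 2 ^ L := by
            refine mul_le_mul_of_nonneg_right ?_ (by positivity)
            calc (2 : ℝ) = 2 ^ 1 := (pow_one _).symm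
              _ ≤ 2 ^ L := pow_le_pow_right₀ one_le_two hL
        _ = 4 ^ L := by rw [← mul_pow]; norm_num
    have h3 : (4 : ℝ) ^ L ≤ M ^ (5 * δ / 16) := by
      calc (4 : ℝ) ^ L ≤ ((m : ℝ) ^ (5 * δ / 16)) ^ L := pow_le_pow_left₀ (by norm_num) h4m L
        _ = M ^ (5 * δ / 16) := capacityTransferK6_rpow_pow_comm hm0R _ _
    have h4 : (p : ℝ) ≤ M ^ (1 + 5 * δ / 16) := by
      calc (p : ℝ) ≤ 4 ^ L * M := h1.trans h2
        _ ≤ M ^ (5 * δ / 16) * M := mul_le_mul_of_nonneg_right h3 hM0.le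
        _ = M ^ (5 * δ / 16 + 1) := by rw [Real.rpow_add_one hM0.ne']
        _ = M ^ (1 + 5 * δ / 16) := by rw [add_comm]
    have h5 : 1 + 5 * δ / 16 ≤ (1 / 2 - δ / 16) * (2 + δ) := by nlinarith
    calc (p : ℝ) ≤ M ^ (1 + 5 * δ / 16) := h4
      _ ≤ M ^ ((1 / 2 - δ / 16) * (2 + δ)) := Real.rpow_le_rpow_of_exponent_le hM1 h5
      _ = x ^ (2 + δ) := by rw [hx, Real.rpow_mul hM0.le]
      _ ≤ ((⌈x⌉₊ : ℕ) : ℝ) ^ (2 + δ) := Real.rpow_le_rpow hx0 hxn (by linarith)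
  · -- `n ^ (2 - δ) ≤ (m ^ (1 - δ/16)) ^ L`
    have h1 : ((⌈x⌉₊ : ℕ) : ℝ) ^ (2 - δ) ≤ (2 * x) ^ (2 - δ) :=
      Real.rpow_le_rpow hn0 hn2x (by linarith)
    have h2 : (2 * x) ^ (2 - δ) = 2 ^ (2 - δ) * M ^ ((1 / 2 - δ / 16) * (2 - δ)) := by
      rw [Real.mul_rpow zero_le_two hx0, hx, ← Real.rpow_mul hM0.le]
    have h3 : (2 : ℝ) ^ (2 - δ) ≤ 4 := by
      calc (2 : ℝ) ^ (2 - δ) ≤ 2 ^ (2 : ℝ) :=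
            Real.rpow_le_rpow_of_exponent_le one_le_two (by linarith)
        _ = 4 := by norm_num
    have h4 : (1 / 2 - δ / 16) * (2 - δ) ≤ 1 - 9 * δ / 16 := by nlinarith
    calc ((⌈x⌉₊ : ℕ) : ℝ) ^ (2 - δ) ≤ 2 ^ (2 - δ) * M ^ ((1 / 2 - δ / 16) * (2 - δ)) :=
          h1.trans_eq h2
      _ ≤ 4 * M ^ (1 - 9 * δ / 16) :=
          mul_le_mul h3 (Real.rpow_le_rpow_of_exponent_le hM1 h4) (by positivity) (by norm_num)
      _ ≤ M ^ (δ / 2) * M ^ (1 - 9 * δ / 16) := mul_le_mul_of_nonneg_right h4M (by positivity)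
      _ = M ^ (1 - δ / 16) := by rw [← Real.rpow_add hM0]; congr 1; ring
      _ = ((m : ℝ) ^ (1 - δ / 16)) ^ L := (capacityTransferK6_rpow_pow_comm hm0R _ _).symm

/-! ## The registered stub -/

/-- **Stub `stub_capacityTransfer` (capacity gadgets give every slice `0 < δ ≤ 1` of the crux), explicit
route.**  Take `ε := δ/16` and a level `m ≥ max m₀ 1` (`m₀` from `capacityTransferK6_bookkeeping`) with its
gadget `(P c, Q c)_{c<r}` in `ℤ/m` and code `W ⊆ (Fin L → Fin r)`.  Let `p` be a prime with
`(2m)^L < p ≤ 2·(2m)^L` (Bertrand) and `φ x := (∑ₜ val (x t) · (2m)^t) mod p` the base-`2m` valuation of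
a word `x : Fin L → ℤ/m` reduced mod `p`; `φ` reflects two-fold sums and is injective.  Number the first
`n := ⌈(m^L)^{1/2-δ/16}⌉₊ ≤ |W|` code words `w₀, …, w_{n-1}` (through `W.equivFin`) and put
`A i := φ '' ∏ₜ P (wᵢ t)`, `B i := φ '' ∏ₜ Q (wᵢ t)`.  Clause (W): `(x-x')+(y-y') = 0` on images pulls
back to `a + b = a' + b'` on words, coordinatewise `(a t - a' t) + (b t - b' t) = 0`, and each letter is
direct.  Clause (X): for `i ≠ k` the code separates `wᵢ ≠ w_k` at some `t`, where `a + b = a' + b'` reads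
`b' t - a t = b t - a' t` — a cross difference `Q (w_k t) - P (wᵢ t)` equal to a diagonal one
`Q (w_j t) - P (w_j t)`, excluded.  Sizes: `|A i||B i| = ∏ₜ |P (wᵢ t)||Q (wᵢ t)| ≥ (m^{1-δ/16})^L ≥ n^{2-δ}`
and `p ≤ n^{2+δ}` by the bookkeeping. -/
theorem stub_capacityTransfer
    (h : ∀ ε : ℝ, 0 < ε → ∀ m₀ : ℕ, ∃ m ≥ m₀, ∃ r L : ℕ, ∃ P Q : Fin r → Finset (ZMod m),
      ∃ W : Finset (Fin L → Fin r),
        (∀ c : Fin r, ∀ x ∈ P c, ∀ x' ∈ P c, ∀ y ∈ Q c, ∀ y' ∈ Q c,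
            (x - x') + (y - y') = 0 → x = x' ∧ y = y') ∧
        (∀ i ∈ W, ∀ k ∈ W, i ≠ k → ∃ t : Fin L,
            ∀ x ∈ P (i t), ∀ y ∈ Q (k t), ∀ c : Fin r, ∀ x' ∈ P c, ∀ y' ∈ Q c, y - x ≠ y' - x') ∧
        1 ≤ L ∧ ((m : ℝ) ^ (L : ℝ)) ^ (1 / 2 - ε) ≤ (W.card : ℝ) ∧
        ∀ c : Fin r, (m : ℝ) ^ (1 - ε) ≤ (((P c).card * (Q c).card : ℕ) : ℝ))
    {δ : ℝ} (hδ : 0 < δ) (hδ1 : δ ≤ 1) : PrimeTwoFamiliesAt δ := by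
  classical
  intro n₀
  obtain ⟨m₀, hm₀⟩ := capacityTransferK6_bookkeeping hδ hδ1 n₀
  obtain ⟨m, hm, r, L, P, Q, W, hD, hC, hL, hWcard, hPQ⟩ := h (δ / 16) (by positivity) (max m₀ 1)
  have hm₀m : m₀ ≤ m := le_trans (le_max_left _ _) hm
  have hm1 : 1 ≤ m := le_trans (le_max_right _ _) hm
  haveI : NeZero m := ⟨by omega⟩
  -- a Bertrand prime above `R = (2m)^L`
  obtain ⟨p, hp, hRp, hp2R⟩ := Nat.exists_prime_lt_and_le_two_mul ((2 * m) ^ L) (by positivity)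
  -- the explicit host map `φ a = V a mod p`, `V a = ∑ₜ val (a t) · (2m)^t`: reflects two-fold sums,
  -- injective
  let φ : (Fin L → ZMod m) → ZMod p := fun a => ((∑ t, (a t).val * (2 * m) ^ (t : ℕ) : ℕ) : ZMod p)
  have hφ : ∀ a b a' b', φ a + φ b = φ a' + φ b' → a + b = a' + b' := by
    intro a b a' b' he
    apply wordVal_reflect
    have he' : ((∑ t, (a t).val * (2 * m) ^ (t : ℕ) + ∑ t, (b t).val * (2 * m) ^ (t : ℕ) : ℕ) :
        ZMod p) = ((∑ t, (a' t).val * (2 * m) ^ (t : ℕ) + ∑ t, (b' t).val * (2 * m) ^ (t : ℕ) : ℕ) :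
        ZMod p) := by
      rw [Nat.cast_add, Nat.cast_add]; exact he
    rwa [ZMod.natCast_eq_natCast_iff', Nat.mod_eq_of_lt ((wordVal_add_lt a b).trans hRp),
      Nat.mod_eq_of_lt ((wordVal_add_lt a' b').trans hRp)] at he'
  have hφinj : Function.Injective φ := by
    intro a a' he
    have := hφ a 0 a' 0 (by rw [he])
    simpa using this
  -- the explicit number of pairs, and the first `n` code words
  obtain ⟨n, hn₀, hnN, hpn, hnP⟩ := hm₀ m hm₀m L hL W.card hWcard p hp2R
  let w : Fin n → Fin L → Fin r := fun i => (W.equivFin.symm (Fin.castLE hnN i) : W)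
  have hwW : ∀ i, w i ∈ W := fun i => (W.equivFin.symm (Fin.castLE hnN i)).2
  have hwinj : Function.Injective w := fun i k hik =>
    Fin.castLE_injective hnN (W.equivFin.symm.injective (Subtype.ext hik))
  -- the blocks
  refine ⟨n, hn₀, p, hp, fun i => (Fintype.piFinset fun t => P (w i t)).image φ,
    fun i => (Fintype.piFinset fun t => Q (w i t)).image φ, ?_, ?_, hpn, ?_⟩
  · -- clause (W): every block pair is direct
    intro i x hx x' hx' y hy y' hy' h0
    simp only [Finset.mem_image, Fintype.mem_piFinset] at hx hx' hy hy'
    obtain ⟨a, ha, rfl⟩ := hx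
    obtain ⟨a', ha', rfl⟩ := hx'
    obtain ⟨b, hb, rfl⟩ := hy
    obtain ⟨b', hb', rfl⟩ := hy'
    have hs : a + b = a' + b' := hφ a b a' b' (by linear_combination h0)
    have key : ∀ t, a t = a' t ∧ b t = b' t := fun t =>
      hD (w i t) (a t) (ha t) (a' t) (ha' t) (b t) (hb t) (b' t) (hb' t)
        (by have := congrFun hs t; simp only [Pi.add_apply] at this; linear_combination this)
    obtain ⟨rfl, rfl⟩ : a = a' ∧ b = b' := ⟨funext fun t => (key t).1, funext fun t => (key t).2⟩
    exact ⟨rfl, rfl⟩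
  · -- clause (X): cross relations identify the outer blocks
    intro i j k x hx x' hx' y hy y' hy' h0
    simp only [Finset.mem_image, Fintype.mem_piFinset] at hx hx' hy hy'
    obtain ⟨a, ha, rfl⟩ := hx
    obtain ⟨a', ha', rfl⟩ := hx'
    obtain ⟨b, hb, rfl⟩ := hy
    obtain ⟨b', hb', rfl⟩ := hy'
    have hs : a + b = a' + b' := hφ a b a' b' (by linear_combination h0)
    by_contra hik
    obtain ⟨t, ht⟩ := hC (w i) (hwW i) (w k) (hwW k) fun e => hik (hwinj e)
    have hst : b' t - a t = b t - a' t := by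
      have := congrFun hs t; simp only [Pi.add_apply] at this; linear_combination -this
    exact ht (a t) (ha t) (b' t) (hb' t) (w j t) (a' t) (ha' t) (b t) (hb t) hst
  · -- co-volume: `n ^ (2-δ) ≤ (m ^ (1-δ/16)) ^ L ≤ ∏ₜ |P (w i t)| |Q (w i t)| = |A i| |B i|`
    intro i
    simp only [Finset.card_image_of_injective _ hφinj, Fintype.card_piFinset]
    rw [← Finset.prod_mul_distrib]
    refine hnP.trans ?_
    rw [← Fin.prod_const]
    push_cast
    exact Finset.prod_le_prod (fun t _ => by positivity) fun t _ => by exact_mod_cast hPQ (w i t)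

end Summit.MatrixMultiplication.MatrixMultiplication.Theorems.PrimeTwoFamilies.CapacityTransferK6
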